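import Mathlib
import HarnessLib
import Summits.Ventures.LatticeQCDFlow.Scoring.ThinnedPathLaw
import Summits.Ventures.LatticeQCDFlow.Scoring.FlowSamplerAutocorrelation

/-!
# The exact flow sampler, every `k`-th configuration of ONE run — UNCONDITIONAL on `SU(n)^E`: the
# recorded stream has the path law of the `Kᵏ`-chain, so the thinning certificates hold for it

HONEST FRAMING: exact (Metropolis-corrected) sampling algorithms for lattice gauge theory;
figures of merit are autocorrelation/cost numbers at stated couplings and volumes; no
continuum-physics claim.

Venture `LatticeQCDFlow` (cell pub-lqcd), topic `Scoring`; FANOUT row 8 (`s0-cpn-nemc`, GEN-15).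
NEW WORK of the cell, not a published result; no definition is introduced.
`Scoring/FlowSamplerParallel.lean` (`flowSampler_thinned`) certified the sampler that records
every `k`-th flow-MCMC configuration MODELLED as the chain with kernel `nHit K k`, and listed under
NOT CLAIMED "that the recorded states of ONE stream thinned by `k` have the path law of the
`Kᵏ`-chain".  `Scoring/ThinnedPathLaw.lean` (`chain_map_thin`) proves exactly that, for every Markov
kernel; this file is the SU(n)^E instance, composed with the tree's exact flow-MCMC theorem
`Exactness.flowSampler_exact_doeblin` (row 30 / lean-2, UNCONDITIONAL via `jacobianFormula_holds`:
Doeblin constant `e^{−2δ}` from a uniform defect `δ` of Lüscher's flow equation).  Nothing is cited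
as a fact.

## Content (hypotheses of `Scoring.flowSampler_autocorrelation`; `K = indepMH q w` EXACT for
## `π = 𝒵⁻¹e^{−S}D[U]`; `P_{μ₀,K}` the law of ONE flow-MCMC run from `μ₀`; `|f| ≤ C`,
## `C' = C + |πf|`, `ε_k = 1 − (1 − e^{−2δ})^k`)

* **`flowSampler_thinned_path`** — for every `k ≥ 1`: the image of `P_{μ₀,K}` under
  `x ↦ (i ↦ x (k i))` IS `P_{μ₀,Kᵏ}` (every initial law `μ₀`), and therefore, for the configurations
  `U_0, U_k, U_{2k}, …` OF THE RUN ITSELF, from ANY start, every `m ≥ 1`, `0 < η ≤ 1`: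
  `E[((1/m) Σ_{i<m} f(U_{k i}) − πf)²] ≤ (2/ε_k − 1) Var_π f/m + 16 C'²/(ε_k² m²)`,
  `P(|(1/m) Σ_{i<m} f(U_{k i}) − πf| > 4C'/(ε_k m) + √(8 C'² log(2/η)/(ε_k² m))) ≤ η`,
  and, for the run started in `π`, `Var[(1/m) Σ_{i<m} f(U_{k i})] ≤ (2/ε_k − 1) Var_π f/m`.

Reading (value-free): the modelling caveat of `Scoring/FlowSamplerParallel.lean` is discharged —
storing every `k`-th configuration of an exact flow-MCMC run is certified at
`ε_k = 1 − (1 − e^{−2δ})^k` in every bound of the row, as a statement about that run.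
NOT CLAIMED: any value of `δ`; unbounded observables.
-/

noncomputable section

namespace Summit.Ventures.LatticeQCDFlow.Scoring

open MeasureTheory ProbabilityTheory Filter Finset Summit.Ventures.LatticeQCDFlow.Exactness
open Literature.MathematicalPhysics.QuantumFieldTheory
open Literature.MathematicalPhysics.QuantumFieldTheory.Luscher2010
open Summit.Ventures.LatticeQCDFlow.TrivializingMaps
open scoped ENNReal Matrix Matrix.Norms.Frobenius ContDiff

variable {d L n : ℕ} [NeZero L]

/-- **Every `k`-th configuration of ONE exact flow-MCMC run — UNCONDITIONAL, any start.**  See the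
module docstring. -/
theorem flowSampler_thinned_path (B : SuBasis n)
    {S : AmbConfig d L n → ℝ} (hS : ContDiff ℝ ∞ S) {F : ℝ → AmbConfig d L n → ℝ}
    (hF : ContDiff ℝ ∞ fun p : ℝ × AmbConfig d L n => F p.1 p.2)
    {Φ : ℝ → GaugeConfig d L (Matrix.specialUnitaryGroup (Fin n) ℂ) →
      GaugeConfig d L (Matrix.specialUnitaryGroup (Fin n) ℂ)}
    (hΦ : IsFlowMap (fun t W => -linkGrad B (F t) W) Φ) {c : ℝ → ℝ} {δ : ℝ}
    (hδ : ∀ t ∈ Set.Icc (0 : ℝ) 1, ∀ U : GaugeConfig d L (Matrix.specialUnitaryGroup (Fin n) ℂ),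
      |luscherL B S t (F t) (WilsonFlow.coeConfig U) - S (WilsonFlow.coeConfig U) - c t| ≤ δ)
    (q : Measure (GaugeConfig d L (Matrix.specialUnitaryGroup (Fin n) ℂ))) [IsProbabilityMeasure q]
    (hq : q = Measure.map (Φ 1) (trivialMeasure (Matrix.specialUnitaryGroup (Fin n) ℂ) d L)) :
    ∃ w : GaugeConfig d L (Matrix.specialUnitaryGroup (Fin n) ℂ) → ℝ, ∃ hw : Measurable w,
      (q.withDensity fun U => ENNReal.ofReal (w U)) =
        boltzmannMeasure (fun U : GaugeConfig d L (Matrix.specialUnitaryGroup (Fin n) ℂ) =>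
          S (WilsonFlow.coeConfig U)) ∧
      Kernel.Invariant (indepMH q w)
        (boltzmannMeasure fun U : GaugeConfig d L (Matrix.specialUnitaryGroup (Fin n) ℂ) =>
          S (WilsonFlow.coeConfig U)) ∧
      ∀ k : ℕ, k ≠ 0 →
        let π := boltzmannMeasure fun U : GaugeConfig d L (Matrix.specialUnitaryGroup (Fin n) ℂ) =>
          S (WilsonFlow.coeConfig U)
        haveI : Fact (Measurable w) := ⟨hw⟩
        haveI := isMarkovKernel_nHit (indepMH q w) k
        ∀ (μ₀ : Measure (GaugeConfig d L (Matrix.specialUnitaryGroup (Fin n) ℂ))) [IsProbabilityMeasure μ₀],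
          let P := Kernel.trajMeasure
            (X := fun _ : ℕ => GaugeConfig d L (Matrix.specialUnitaryGroup (Fin n) ℂ)) μ₀
            (fun j : ℕ => (indepMH q w).comap
              (fun y : (i : ↥(Finset.Iic j)) → GaugeConfig d L (Matrix.specialUnitaryGroup (Fin n) ℂ) =>
                y ⟨j, Finset.mem_Iic.2 le_rfl⟩) (measurable_pi_apply _))
          P.map (fun (x : ℕ → GaugeConfig d L (Matrix.specialUnitaryGroup (Fin n) ℂ)) (i : ℕ) =>
              x (k * i))
            = Kernel.trajMeasure
              (X := fun _ : ℕ => GaugeConfig d L (Matrix.specialUnitaryGroup (Fin n) ℂ)) μ₀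
              (fun j : ℕ => (nHit (indepMH q w) k).comap
                (fun y : (i : ↥(Finset.Iic j)) → GaugeConfig d L (Matrix.specialUnitaryGroup (Fin n) ℂ) =>
                  y ⟨j, Finset.mem_Iic.2 le_rfl⟩) (measurable_pi_apply _)) ∧
          ∀ (f : GaugeConfig d L (Matrix.specialUnitaryGroup (Fin n) ℂ) → ℝ), Measurable f →
          ∀ C : ℝ, (∀ U, |f U| ≤ C) → ∀ m : ℕ, m ≠ 0 →
          ∫ x, ((∑ i ∈ Finset.range m, f (x (k * i))) / m - ∫ V, f V ∂π) ^ 2 ∂P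
              ≤ (2 / (1 - (1 - Real.exp (-(2 * δ))) ^ k) - 1) * (∫ V, (f V - ∫ V', f V' ∂π) ^ 2 ∂π) / m
                + 16 * (C + |∫ V, f V ∂π|) ^ 2
                  / ((1 - (1 - Real.exp (-(2 * δ))) ^ k) ^ 2 * (m : ℝ) ^ 2) ∧
            (∀ η : ℝ, 0 < η → η ≤ 1 →
              P.real {x | 4 * (C + |∫ V, f V ∂π|) / ((1 - (1 - Real.exp (-(2 * δ))) ^ k) * m)
                    + Real.sqrt (8 * (C + |∫ V, f V ∂π|) ^ 2 * Real.log (2 / η)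
                        / ((1 - (1 - Real.exp (-(2 * δ))) ^ k) ^ 2 * m))
                  < |(∑ i ∈ Finset.range m, f (x (k * i))) / m - ∫ V, f V ∂π|} ≤ η) ∧
            (μ₀ = π →
              Var[fun x : ℕ → GaugeConfig d L (Matrix.specialUnitaryGroup (Fin n) ℂ) =>
                  (∑ i ∈ Finset.range m, f (x (k * i))) / m; P]
                ≤ (2 / (1 - (1 - Real.exp (-(2 * δ))) ^ k) - 1)
                  * (∫ V, (f V - ∫ V', f V' ∂π) ^ 2 ∂π) / m) := by
  obtain ⟨w, hw, -, -, hπ, hinv, -, hdoeb⟩ := flowSampler_exact_doeblin B hS hF hΦ hδ q hq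
  haveI : Fact (Measurable w) := ⟨hw⟩
  have hS'c : Continuous fun U : GaugeConfig d L (Matrix.specialUnitaryGroup (Fin n) ℂ) =>
      S (WilsonFlow.coeConfig U) := hS.continuous.comp WilsonFlow.continuous_coeConfig
  haveI := isProbabilityMeasure_boltzmannMeasure (d := d) (L := L) hS'c
  have hε0 : 0 < ENNReal.ofReal (Real.exp (-(2 * δ))) := ENNReal.ofReal_pos.2 (Real.exp_pos _)
  have hr : (ENNReal.ofReal (Real.exp (-(2 * δ)))).toReal = Real.exp (-(2 * δ)) :=
    ENNReal.toReal_ofReal (Real.exp_pos _).le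
  refine ⟨w, hw, hπ, hinv, fun k hk μ₀ _ => ⟨?_, fun f hf C hC m hm => ⟨?_, ?_, ?_⟩⟩⟩
  · exact chain_map_thin (indepMH q w) μ₀ k
  · have h := chain_thinned_mse_le_of_doeblin (κ := indepMH q w) (μ₀ := μ₀) hinv
      (fun x B hB => hdoeb x hB) hε0 hk hf hC hm
    rw [hr] at h
    exact h
  · intro η hη0 hη1
    have h := chain_thinned_confidence_of_doeblin (κ := indepMH q w) (μ₀ := μ₀) hinv
      (fun x B hB => hdoeb x hB) hε0 hk hf hC hm hη0 hη1
    rw [hr] at h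
    exact h
  · intro hμ₀
    subst hμ₀
    have h := chain_thinned_variance_le_of_doeblin (κ := indepMH q w) hinv
      (fun x B hB => hdoeb x hB) hε0 hk hf hC hm
    rw [hr] at h
    exact h

end Summit.Ventures.LatticeQCDFlow.Scoring

end
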